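import Literature.NumberTheory.EllipticCurves.ZpExtensionUnramifiedProofs
import Literature.NumberTheory.EllipticCurves.Gross2004.RationalCharacterFrobeniusProofs
import HarnessLib

set_option autoImplicit false

/-!
# The `p`-adic Artin exponent of an ideal prime to `p` along a `ℤ_p`-extension, and Artin reciprocity
# LEVEL-WISE for the characters of the layers `K_n/K`

Topic `NumberTheory/EllipticCurves` (companion of `ZpExtension.lean`, `ZpExtensionUnramifiedProofs.lean`; namespace
`Literature.NumberTheory.EllipticCurves.ZpExtension` = path + the object).  Cell `bsd-cm`, seat `bsd-cm-prr-ty1` g35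
(literature-prover), row K2C-9 (C6a) of crux `stmt-BirchSwinnertonDyer-19945`: the field (art′) of the re-typed datum
`GenusSeven.KatoExpDatum` (`Summits/…/Additive/RamifiedSevenGenusKatoExpDatum.lean`) reads, for the cyclotomic
`ℤ₇`-extension `Kℚ_∞/K` of the CM field with topological generator `γK`: «`χ(𝔟) = χ(γK)^m` for every character `χ` of
`Gal(Kℚ_n/K)` and every natural `m ≡ κ(𝔟) (mod 7^n)`», `κ(𝔟) ∈ ℤ₇` the `7`-adic Artin exponent of the admissible twist `𝔟`.
This file CONSTRUCTS that exponent and PROVES that law for an arbitrary number field `K`, prime `p`, `ℤ_p`-extension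
`κ : Γ_K →ₜ* ℤ_p` and topological generator `γ` — definitions with bodies and theorems only; no named fact, no instance.

## Mathematics (Washington §13.1–13.2, Prop. 13.2; Neukirch–Schmidt–Wingberg XI §1–§2; Neukirch VII §10)

A `ℤ_p`-extension `K_∞ = K̄^{ker κ}` is unramified outside `p` (Washington, Prop. 13.2; tree THEOREM
`ZpExtension.inertia_le_kerSubgroup_holds`): for a finite place `v ∤ p` every inertia group `I_𝔓 ≤ Γ_K`, `𝔓 ∣ v`, lies in
`ker κ`, so `κ(Frob_v) ∈ ℤ_p` is well defined (the image of the Artin symbol `(v, K_∞/K) ∈ Gal(K_∞/K) ≅ ℤ_p` under `κ`),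
and for a nonzero ideal `𝔞 = ∏ v^{e_v}` prime to `p` the ARTIN EXPONENT is `κ(𝔞) := Σ_v e_v·κ(Frob_v) ∈ ℤ_p`
(`artinExponent`).  For a continuous character `χ : Γ_K → ℂ^×` trivial on `U_n := κ⁻¹(pⁿℤ_p) = Gal(K̄/K_n)` (a character of
the cyclic group `Gal(K_n/K) = ⟨γ⟩ ≅ ℤ/pⁿ` when `κ(γ) = 1`, `IsTopGenerator`): `χ` is unramified at every `v ∤ p`, its value on
ideals `χ(𝔞) = ∏_v χ(Frob_v)^{e_v}` (the tree's `heckeIdealValue`, arithmetic Frobenius, «extended by zero»; Neukirch VII §10,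
proof of (10.6); tree `Gross2004.heckeValueAt_eq_of_isUnramifiedAt`) equals `χ(γ)^m` for EVERY natural number `m` with
`m ≡ κ(𝔞) (mod pⁿ)` (`heckeIdealValue_eq_pow_of_toZModPow_artinExponent`), because `g·γ^{-m} ∈ U_n` whenever
`κ(g) ≡ m (mod pⁿ)` (`apply_eq_pow_of_toZModPow_eq`).

## Contents
§1 a chosen prime `𝔓_v ∣ v` of `ℤ̄_K` and a chosen arithmetic Frobenius `Frob_v` (`primeAbove`, `frobChoice`); §2 the
exponent `frobExponent κ v = κ(Frob_v)` and `artinExponent κ 𝔞`, finiteness of the support, a natural lift at every level;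
§3 the level-wise reciprocity: `apply_eq_pow_of_toZModPow_eq` (group elements), `chi_pow_prime_pow_eq_one`,
`heckeValueAt_eq_apply_frobChoice` (unramified evaluation), ★ `heckeIdealValue_eq_pow_of_toZModPow_artinExponent` (ideals
prime to `p`, pointwise hypothesis) and its `IsCoprime` form.  The choices in §1 are immaterial for §3 (any Frobenius at any
prime above `v` has the same `κ`-value since `I_𝔓 ≤ ker κ` and `ℤ_p` is abelian); this independence is not needed here and
is not proved.
-- TODO(general form): independence of `frobExponent` from the choices; the Artin MAP `Cl_𝔪(K) → Gal(K_n/K)` as a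
-- homomorphism on a ray class group (Neukirch VI (7.1)) rather than its shadow on characters.

HONEST LABEL: general infrastructure (Artin symbol of a `ℤ_p`-extension read through `κ`); proves nothing about any
elliptic curve; no summit statement is touched.

References: L. C. Washington, *Introduction to Cyclotomic Fields* (1997), §13.1 and Prop. 13.2 [Washington1997];
J. Neukirch, A. Schmidt, K. Wingberg (2008), XI §1–§2 [NeukirchSchmidtWingberg2008]; J. Neukirch, *Algebraic Number
Theory* (1999), VI (7.1), VII §10 (10.6) [NeukirchANT1999]; K. Kato, Astérisque 295 (2004), (15.12.2) (p. 263: the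
operator `σ_𝔞 ∈ O[[Gal(K_∞/K)]]`) [Kato2004Asterisque]; tree `ZpExtension.lean`, `ZpExtensionUnramifiedProofs.lean`,
`Gross2004/RationalCharacterFrobeniusProofs.lean`, `RankinSelbergLFunctionK.lean` (`heckeValueAt`, `heckeIdealValue`).
-/

noncomputable section

open scoped NumberField
open Field IsDedekindDomain NumberField UniqueFactorizationMonoid
open Literature.NumberTheory.GaloisRepresentations

namespace Literature.NumberTheory.EllipticCurves.ZpExtension

universe u

variable {K : Type u} [Field K]

/-! ## §0 Generic: a topological generator and the characters of the layers -/

section Generic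

variable {p : ℕ} [Fact p.Prime] (κ : ZpExtension K p) {γ : absoluteGaloisGroup K}

/-- `g^{pⁿ} ∈ U_n = κ⁻¹(pⁿℤ_p)` for every `g` (`κ(g^{pⁿ}) = pⁿκ(g)`); a private copy of the tree's
`ZpExtension.pow_prime_pow_mem_layerSubgroup` (`Kato2004/IwasawaH1FiniteOfInjectivityProofs.lean`, not imported to keep
this file light). [cite: Washington1997, §13.1] -/
private theorem pow_prime_pow_mem_layerSubgroup_aux (g : absoluteGaloisGroup K) (n : ℕ) :
    g ^ p ^ n ∈ κ.layerSubgroup n := by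
  rw [ZpExtension.mem_layerSubgroup, map_pow, toAdd_pow, nsmul_eq_mul, Nat.cast_pow]
  exact Dvd.intro _ rfl

/-- For `χ` trivial on `U_n` and any `g ∈ Γ_K`: `χ(g)^{pⁿ} = 1` (in `ℂ`). [cite: Washington1997, §13.1] -/
theorem chi_pow_prime_pow_eq_one {n : ℕ} (χ : absoluteGaloisGroup K →ₜ* ℂˣ)
    (hχ : ∀ σ ∈ κ.layerSubgroup n, χ σ = 1) (g : absoluteGaloisGroup K) : (((χ g : ℂˣ)) : ℂ) ^ p ^ n = 1 := by
  have h := hχ _ (pow_prime_pow_mem_layerSubgroup_aux κ g n)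
  rw [map_pow] at h
  rw [← Units.val_pow_eq_pow_val, h, Units.val_one]

/-- **`χ(g) = χ(γ)^m` whenever `κ(g) ≡ m (mod pⁿ)`**, for `χ` trivial on `U_n` and a topological generator `γ`:
`g·γ^{-m} ∈ U_n` since `κ(g·γ^{-m}) = κ(g) − m ∈ pⁿℤ_p` (`PadicInt.ker_toZModPow`).  The group-element form of Artin
reciprocity on the cyclic layer `Gal(K_n/K) = ⟨γ⟩ ≅ ℤ/pⁿ`. [cite: Washington1997, §13.1] [cite: NeukirchSchmidtWingberg2008, XI §1] -/
theorem apply_eq_pow_of_toZModPow_eq (hγ : κ.IsTopGenerator γ) {n : ℕ} (χ : absoluteGaloisGroup K →ₜ* ℂˣ)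
    (hχ : ∀ σ ∈ κ.layerSubgroup n, χ σ = 1) (g : absoluteGaloisGroup K) {m : ℕ}
    (hm : PadicInt.toZModPow n (κ g).toAdd = (m : ZMod (p ^ n))) : χ g = χ γ ^ m := by
  have hγ' : κ γ = Multiplicative.ofAdd 1 := hγ
  have hmem : g * (γ ^ m)⁻¹ ∈ κ.layerSubgroup n := by
    rw [ZpExtension.mem_layerSubgroup, map_mul, map_inv, map_pow, hγ', ← ofAdd_nsmul, toAdd_mul, toAdd_inv,
      toAdd_ofAdd, nsmul_eq_mul, mul_one, ← Ideal.mem_span_singleton, ← PadicInt.ker_toZModPow, RingHom.mem_ker,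
      ← sub_eq_add_neg, map_sub, hm, map_natCast, sub_self]
  have h1 := hχ _ hmem
  rw [map_mul, map_inv, map_pow, mul_inv_eq_one] at h1
  exact h1

/-- Powers of a root of unity only see the exponent `mod` its order: `u^{N} = 1`, `a ≡ b (mod N)` ⇒ `u^a = u^b`. [folklore] -/
private theorem pow_eq_pow_of_natCast_zmod_eq {M : Type*} [Monoid M] {u : M} {N : ℕ} (hu : u ^ N = 1) {a b : ℕ}
    (h : (a : ZMod N) = (b : ZMod N)) : u ^ a = u ^ b := by
  rw [pow_eq_pow_mod a hu, pow_eq_pow_mod b hu, (ZMod.natCast_eq_natCast_iff' a b N).mp h]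

end Generic

variable [NumberField K]

/-! ## §1 A chosen prime above a finite place and a chosen arithmetic Frobenius there -/

/-- A chosen prime `𝔓_v` of `ℤ̄_K` above the finite place `v` of the number field `K` (there is one:
`HeightOneSpectrum.primesAbove_nonempty`). [cite: NeukirchANT1999, Ch. I §9 (before (9.1))] -/
def primeAbove (v : HeightOneSpectrum (𝓞 K)) : Ideal (absIntegers (𝓞 K) K) :=
  (HeightOneSpectrum.primesAbove_nonempty v).some

/-- `𝔓_v` lies above `v`. [cite: NeukirchANT1999, Ch. I §9 (before (9.1))] -/
theorem primeAbove_mem (v : HeightOneSpectrum (𝓞 K)) : primeAbove v ∈ v.primesAbove :=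
  (HeightOneSpectrum.primesAbove_nonempty v).some_mem

/-- A chosen ARITHMETIC Frobenius `Frob_v ∈ Γ_K` at `𝔓_v` (`σ·x ≡ x^{Nv} mod 𝔓_v`; there is one:
`HeightOneSpectrum.exists_isArithFrobAt_of_mem_primesAbove_holds`). [cite: NeukirchANT1999, Ch. I §9 Prop. (9.4) and Def. (9.5)] -/
def frobChoice (v : HeightOneSpectrum (𝓞 K)) : absoluteGaloisGroup K :=
  Classical.choose (HeightOneSpectrum.exists_isArithFrobAt_of_mem_primesAbove_holds (primeAbove_mem v))

/-- `Frob_v` is an arithmetic Frobenius at `𝔓_v`. [cite: NeukirchANT1999, Ch. I §9 Prop. (9.4)] -/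
theorem isArithFrobAt_frobChoice (v : HeightOneSpectrum (𝓞 K)) :
    IsArithFrobAt (𝓞 K) (frobChoice v) (primeAbove v) :=
  Classical.choose_spec (HeightOneSpectrum.exists_isArithFrobAt_of_mem_primesAbove_holds (primeAbove_mem v))

/-! ## §2 The `p`-adic Artin exponent of a place and of an ideal -/

section Exponent

variable {p : ℕ} [Fact p.Prime] (κ : ZpExtension K p)

/-- **`frobExponent κ v = κ(Frob_v) ∈ ℤ_p`**: the image under `κ : Γ_K → ℤ_p` of (a chosen) arithmetic Frobenius at `v` —
for `v ∤ p` this is the Artin symbol `(v, K_∞/K) ∈ Gal(K_∞/K) ≅ ℤ_p` (`K_∞/K` is unramified at `v`, Washington Prop. 13.2).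
[cite: Washington1997, §13.1 and Prop. 13.2] [cite: NeukirchSchmidtWingberg2008, XI §2] -/
def frobExponent (v : HeightOneSpectrum (𝓞 K)) : ℤ_[p] :=
  (κ (frobChoice v)).toAdd

/-- Unfolding `frobExponent`. [cite: Washington1997, §13.1] -/
theorem frobExponent_def (v : HeightOneSpectrum (𝓞 K)) : frobExponent κ v = (κ (frobChoice v)).toAdd := rfl

open scoped Classical in
/-- **`artinExponent κ 𝔞 = κ(𝔞) := Σ_v e_v(𝔞)·κ(Frob_v) ∈ ℤ_p`** for an ideal `𝔞 = ∏ v^{e_v(𝔞)}` of `𝓞 K` (the exponents are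
the multiplicities in `normalizedFactors 𝔞`, the bookkeeping of the tree's `heckeIdealValue`; `0` for `𝔞 = 0` or `𝔞 = 𝓞 K`):
the image under `κ` of the Artin symbol `(𝔞, K_∞/K) = ∏_v Frob_v^{e_v}` — Kato's exponent of the group-like element
`σ_𝔞 ∈ O[[Gal(K_∞/K)]]`, `σ_𝔞 = γ^{κ(𝔞)}`.  Meaningful for `𝔞` prime to `p`.
[cite: Kato2004Asterisque, (15.12.2) (p. 263)] [cite: NeukirchSchmidtWingberg2008, XI §2] -/
def artinExponent (I : Ideal (𝓞 K)) : ℤ_[p] :=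
  ∑ᶠ v : HeightOneSpectrum (𝓞 K), (normalizedFactors I).count v.asIdeal • frobExponent κ v

open scoped Classical in
/-- The places occurring in `normalizedFactors I` form a finite set. [folklore] -/
private theorem finite_setOf_count_ne_zero (I : Ideal (𝓞 K)) :
    {v : HeightOneSpectrum (𝓞 K) | (normalizedFactors I).count v.asIdeal ≠ 0}.Finite := by
  have hsub : {v : HeightOneSpectrum (𝓞 K) | (normalizedFactors I).count v.asIdeal ≠ 0} ⊆
      (fun v : HeightOneSpectrum (𝓞 K) => v.asIdeal) ⁻¹' ((normalizedFactors I).toFinset : Set (Ideal (𝓞 K))) := by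
    intro v hv
    exact Finset.mem_coe.mpr (Multiset.mem_toFinset.mpr (Multiset.count_ne_zero.mp hv))
  exact ((normalizedFactors I).toFinset.finite_toSet.preimage
    fun v _ w _ h => HeightOneSpectrum.ext h).subset hsub

open scoped Classical in
/-- `artinExponent` as a finite sum over any finite set of places containing the prime factors.
[cite: NeukirchSchmidtWingberg2008, XI §2] -/
theorem artinExponent_eq_sum {I : Ideal (𝓞 K)} {s : Finset (HeightOneSpectrum (𝓞 K))}
    (hs : ∀ v : HeightOneSpectrum (𝓞 K), (normalizedFactors I).count v.asIdeal ≠ 0 → v ∈ s) :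
    artinExponent κ I = ∑ v ∈ s, (normalizedFactors I).count v.asIdeal • frobExponent κ v := by
  unfold artinExponent
  refine finsum_eq_sum_of_support_subset _ fun v hv => ?_
  rw [Function.mem_support] at hv
  exact Finset.mem_coe.mpr (hs v fun h0 => hv (by rw [h0, zero_smul]))

/-- Every level `n` has a natural lift `m ≡ κ(𝔞) (mod pⁿ)` (e.g. `(κ(𝔞) mod pⁿ).val`). [cite: NeukirchSchmidtWingberg2008, XI §1] -/
theorem exists_nat_toZModPow_artinExponent (I : Ideal (𝓞 K)) (n : ℕ) :
    ∃ m : ℕ, PadicInt.toZModPow n (artinExponent κ I) = (m : ZMod (p ^ n)) := by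
  haveI : NeZero (p ^ n) := ⟨pow_ne_zero n (Fact.out : p.Prime).ne_zero⟩
  exact ⟨(PadicInt.toZModPow n (artinExponent κ I)).val, (ZMod.natCast_zmod_val _).symm⟩

end Exponent

/-! ## §3 Artin reciprocity level-wise for the characters of `Gal(K_n/K) = ⟨γ⟩` -/

section Reciprocity

variable {p : ℕ} [Fact p.Prime] (κ : ZpExtension K p) {γ : absoluteGaloisGroup K}

/-- **At a place `v ∤ p` a character of a layer is unramified and `heckeValueAt χ v = χ(Frob_v)`** (for the chosen
Frobenius of §1): the inertia groups above `v` lie in `ker κ ≤ U_n` (`inertia_le_kerSubgroup_holds`, Washington Prop. 13.2),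
so `χ` kills them, and the Euler factor of `χ` at `v` is `1 − χ(Frob_v)T` (Neukirch VII §10, proof of (10.6)).
[cite: Washington1997, Prop. 13.2] [cite: NeukirchANT1999, Ch. VII §10 Thm. (10.6) (proof)] -/
theorem heckeValueAt_eq_apply_frobChoice {n : ℕ} (χ : absoluteGaloisGroup K →ₜ* ℂˣ)
    (hχ : ∀ σ ∈ κ.layerSubgroup n, χ σ = 1) {v : HeightOneSpectrum (𝓞 K)} (hv : ((p : ℕ) : 𝓞 K) ∉ v.asIdeal) :
    heckeValueAt χ v = ((χ (frobChoice v) : ℂˣ) : ℂ) := by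
  have hur : GaloisRep.IsUnramifiedAt v (FramedArtinRep.toArtinRep (FramedRep.ofCharacter χ)) := by
    rw [Gross2004.isUnramifiedAt_ofCharacter_iff]
    intro 𝔓 h𝔓 σ hσ
    exact hχ σ (κ.kerSubgroup_le_layerSubgroup n (inertia_le_kerSubgroup_holds K p κ hv h𝔓 hσ))
  exact Gross2004.heckeValueAt_eq_of_isUnramifiedAt χ hur (primeAbove_mem v) (isArithFrobAt_frobChoice v)

open scoped Classical in
/-- ★ **ARTIN RECIPROCITY LEVEL-WISE ON IDEALS PRIME TO `p`**: for a topological generator `γ` of the `ℤ_p`-extension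
`κ`, a continuous character `χ` of `Γ_K` trivial on `U_n = Gal(K̄/K_n)`, a nonzero ideal `𝔞` none of whose prime factors
contains `p`, and ANY natural number `m` with `m ≡ κ(𝔞) (mod pⁿ)`:  `χ(𝔞) = χ(γ)^m`, where `χ(𝔞) = heckeIdealValue χ 𝔞 =
∏_v χ(Frob_v)^{e_v(𝔞)}` (arithmetic Frobenius, extended by zero) and `κ(𝔞) = artinExponent κ 𝔞`.  Proof: factor by factor
`χ(Frob_v) = χ(γ)^{m_v}` with `m_v ≡ κ(Frob_v)` (`apply_eq_pow_of_toZModPow_eq`), then `Σ e_v m_v ≡ κ(𝔞) ≡ m (mod pⁿ)` and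
`χ(γ)^{pⁿ} = 1`.  This is the inhabitant of the field (art′) of `GenusSeven.KatoExpDatum` for every pinned frame.
[cite: NeukirchANT1999, Ch. VI Thm. (7.1) and Ch. VII §10 (10.6) (proof)] [cite: Washington1997, §13.1 and Prop. 13.2]
[cite: Kato2004Asterisque, (15.12.2) (p. 263)] -/
theorem heckeIdealValue_eq_pow_of_toZModPow_artinExponent (hγ : κ.IsTopGenerator γ) {n : ℕ}
    (χ : absoluteGaloisGroup K →ₜ* ℂˣ) (hχ : ∀ σ ∈ κ.layerSubgroup n, χ σ = 1)
    {I : Ideal (𝓞 K)} (hI : I ≠ ⊥)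
    (hIp : ∀ v : HeightOneSpectrum (𝓞 K), v.asIdeal ∣ I → ((p : ℕ) : 𝓞 K) ∉ v.asIdeal)
    {m : ℕ} (hm : PadicInt.toZModPow n (artinExponent κ I) = (m : ZMod (p ^ n))) :
    heckeIdealValue χ I = (((χ γ : ℂˣ)) : ℂ) ^ m := by
  haveI : NeZero (p ^ n) := ⟨pow_ne_zero n (Fact.out : p.Prime).ne_zero⟩
  -- the finite set of prime factors and the exponents
  set c : HeightOneSpectrum (𝓞 K) → ℕ := fun v => (normalizedFactors I).count v.asIdeal with hc
  set s : Finset (HeightOneSpectrum (𝓞 K)) := (finite_setOf_count_ne_zero I).toFinset with hs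
  have hmem : ∀ v : HeightOneSpectrum (𝓞 K), c v ≠ 0 → v ∈ s := fun v hv => by
    rw [hs, Set.Finite.mem_toFinset]; exact hv
  -- natural lifts `m_v` of `κ(Frob_v) mod pⁿ`
  set mv : HeightOneSpectrum (𝓞 K) → ℕ := fun v => (PadicInt.toZModPow n (frobExponent κ v)).val with hmv
  have hmv_spec : ∀ v, PadicInt.toZModPow n (κ (frobChoice v)).toAdd = (mv v : ZMod (p ^ n)) := fun v => by
    rw [hmv]; exact (ZMod.natCast_zmod_val _).symm
  set u : ℂ := (((χ γ : ℂˣ)) : ℂ) with hu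
  have huN : u ^ p ^ n = 1 := chi_pow_prime_pow_eq_one κ χ hχ γ
  -- factor by factor: `heckeValueAt χ v ^ c v = u ^ (mv v * c v)`
  have hfac : ∀ v : HeightOneSpectrum (𝓞 K), heckeValueAt χ v ^ c v = u ^ (mv v * c v) := by
    intro v
    by_cases hv : c v = 0
    · rw [hv, mul_zero, pow_zero, pow_zero]
    · have hdvd : v.asIdeal ∣ I :=
        dvd_of_mem_normalizedFactors (Multiset.count_ne_zero.mp hv)
      rw [heckeValueAt_eq_apply_frobChoice κ χ hχ (hIp v hdvd),
        apply_eq_pow_of_toZModPow_eq κ hγ χ hχ (frobChoice v) (hmv_spec v), Units.val_pow_eq_pow_val, ← pow_mul]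
  -- the product over the factorisation
  have hprod : heckeIdealValue χ I = u ^ ∑ v ∈ s, mv v * c v := by
    rw [heckeIdealValue, if_neg hI, finprod_eq_prod_of_mulSupport_subset _ (s := s) ?_]
    · rw [← Finset.prod_pow_eq_pow_sum]
      exact Finset.prod_congr rfl fun v _ => hfac v
    · intro v hv
      rw [Function.mem_mulSupport] at hv
      exact Finset.mem_coe.mpr (hmem v fun h0 => hv (by change heckeValueAt χ v ^ c v = 1; rw [h0, pow_zero]))
  -- the exponent `Σ mv·c ≡ κ(I) ≡ m (mod pⁿ)`
  have hexp : ((∑ v ∈ s, mv v * c v : ℕ) : ZMod (p ^ n)) = (m : ZMod (p ^ n)) := by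
    rw [← hm, artinExponent_eq_sum κ hmem, map_sum, Nat.cast_sum]
    refine Finset.sum_congr rfl fun v _ => ?_
    rw [map_nsmul, frobExponent_def, hmv_spec v, nsmul_eq_mul, Nat.cast_mul, mul_comm]
  rw [hprod, pow_eq_pow_of_natCast_zmod_eq huN hexp]

/-- The same with the coprimality hypothesis in the form `IsCoprime 𝔞 (p)` (e.g. from `CM.IsTwist p 𝔣 𝔞`: `𝔞` prime to
`6p𝔣`). [cite: NeukirchANT1999, Ch. VI Thm. (7.1)] [cite: Washington1997, Prop. 13.2] -/
theorem heckeIdealValue_eq_pow_of_isCoprime (hγ : κ.IsTopGenerator γ) {n : ℕ}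
    (χ : absoluteGaloisGroup K →ₜ* ℂˣ) (hχ : ∀ σ ∈ κ.layerSubgroup n, χ σ = 1)
    {I : Ideal (𝓞 K)} (hI : I ≠ ⊥) (hIp : IsCoprime I (Ideal.span {((p : ℕ) : 𝓞 K)}))
    {m : ℕ} (hm : PadicInt.toZModPow n (artinExponent κ I) = (m : ZMod (p ^ n))) :
    heckeIdealValue χ I = (((χ γ : ℂˣ)) : ℂ) ^ m := by
  refine heckeIdealValue_eq_pow_of_toZModPow_artinExponent κ hγ χ hχ hI (fun v hv hpv => ?_) hm
  have hle : I ⊔ Ideal.span {((p : ℕ) : 𝓞 K)} ≤ v.asIdeal :=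
    sup_le (Ideal.le_of_dvd hv) ((Ideal.span_singleton_le_iff_mem _).mpr hpv)
  rw [Ideal.isCoprime_iff_sup_eq.mp hIp, top_le_iff] at hle
  exact v.isPrime.ne_top hle

end Reciprocity

end Literature.NumberTheory.EllipticCurves.ZpExtension

end
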